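import Literature.NumberTheory.GaloisRepresentations.ContinuousRep
import Mathlib.LinearAlgebra.BilinearForm.Orthogonal
import Mathlib.LinearAlgebra.Matrix.BilinearForm
import Mathlib.LinearAlgebra.FiniteDimensional.Lemmas
import HarnessLib

/-!
# No stable line / hyperplane / plane ⇒ irreducible on `K⁴` (stub `stub_irreducible_of_noStableSubspace`)
# — line `sector-klingen-split`

Stub-worker of lead prover-line-stmt-Langlands-13639-c4-0 (cycle 4, 2026-08-17), crux `ResiduallyYoshidaLifting`
(stmt-Langlands-13639).  Pure linear algebra over a field `K`: a matrix representation `r : Γ → GL₄(K)` with no common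
eigen-line, no common row eigen-covector (= no stable hyperplane) and no stable plane (a `4 × 2` matrix `M` with
`M a = 0 ⇒ a = 0` and `r g M = M T_g`) is IRREDUCIBLE on `K⁴` in Mathlib's sense
(`Representation.IsIrreducible = IsSimpleOrder (Subrepresentation _)`).

Proof: a stable submodule `S ⊆ K⁴` has dimension `d ∈ {0, …, 4}`; `d = 0, 4` are `⊥, ⊤`; `d = 1` is a stable line
(`finrank_eq_one_iff'`); for `d = 2` the matrix `M` of a basis of `S` is a stable plane; for `d = 3` the dot-product
orthogonal of `S` (`LinearMap.BilinForm.orthogonal` of `Matrix.toBilin' 1`, dimension `4 - 3 = 1` by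
`LinearMap.BilinForm.finrank_orthogonal`) is a line of covectors stable under `w ↦ w ᵥ* r g`
(`Matrix.dotProduct_mulVec`).  The three dimension lemmas are stated for `Fin n` and an arbitrary family of matrices.
-/

noncomputable section

open scoped Matrix

set_option linter.dupNamespace false
set_option autoImplicit false

namespace Summit.Langlands.Langlands.Cruxes.ResiduallyYoshidaLifting.SectorKlingenSplit.Fibre

open Literature.NumberTheory.GaloisRepresentations

section StableSubmodules

variable {K : Type*} [Field K] {Γ : Type*} {n : ℕ}

/-- A `1`-dimensional submodule of `Kⁿ` stable under a family of matrices is a common EIGEN-LINE. [folklore] -/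
theorem exists_eigenline_of_stable_finrank_eq_one (A : Γ → Matrix (Fin n) (Fin n) K)
    (S : Submodule K (Fin n → K)) (hS : ∀ g, ∀ u ∈ S, A g *ᵥ u ∈ S)
    (h1 : Module.finrank K S = 1) :
    ∃ v : Fin n → K, v ≠ 0 ∧ ∀ g, ∃ c : K, A g *ᵥ v = c • v := by
  obtain ⟨w, hw0, hw⟩ := finrank_eq_one_iff'.mp h1
  refine ⟨(w : Fin n → K), fun h0 => hw0 (Subtype.ext h0), fun g => ?_⟩
  obtain ⟨c, hc⟩ := hw ⟨_, hS g _ w.2⟩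
  exact ⟨c, by simpa using congrArg Subtype.val hc.symm⟩

/-- A `2`-dimensional submodule of `Kⁿ` stable under a family of matrices gives a STABLE PLANE in matrix form:
the `n × 2` matrix `M` of a basis (injective on `K²`) with `A_g M = M T_g`. [folklore] -/
theorem exists_stablePlane_of_stable_finrank_eq_two (A : Γ → Matrix (Fin n) (Fin n) K)
    (S : Submodule K (Fin n → K)) (hS : ∀ g, ∀ u ∈ S, A g *ᵥ u ∈ S)
    (h2 : Module.finrank K S = 2) :
    ∃ M : Matrix (Fin n) (Fin 2) K, (∀ a : Fin 2 → K, M *ᵥ a = 0 → a = 0) ∧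
      ∀ g, ∃ T : Matrix (Fin 2) (Fin 2) K, A g * M = M * T := by
  let b : Module.Basis (Fin 2) K S := Module.finBasisOfFinrankEq K S h2
  let M : Matrix (Fin n) (Fin 2) K := Matrix.of fun i j => (b j : Fin n → K) i
  -- `M a` is the vector with coordinates `a` in the basis `b`
  have hMa : ∀ a : Fin 2 → K, M *ᵥ a = ((b.equivFun.symm a : S) : Fin n → K) := by
    intro a
    rw [Module.Basis.equivFun_symm_apply, Submodule.coe_sum]
    funext i
    simp only [M, Matrix.mulVec, dotProduct, Matrix.of_apply, Finset.sum_apply, Submodule.coe_smul,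
      Pi.smul_apply, smul_eq_mul, mul_comm]
  -- column `j` of `A M` is `A b_j`, column `j` of `M T` is `M T_{•j}`
  have hL : ∀ (B : Matrix (Fin n) (Fin n) K) (i : Fin n) (j : Fin 2),
      (B * M) i j = (B *ᵥ (b j : Fin n → K)) i := by
    intro B i j
    simp only [M, Matrix.mul_apply, Matrix.mulVec, dotProduct, Matrix.of_apply]
  have hR : ∀ (T : Matrix (Fin 2) (Fin 2) K) (i : Fin n) (j : Fin 2),
      (M * T) i j = (M *ᵥ fun l => T l j) i := by
    intro T i j
    simp only [Matrix.mul_apply, Matrix.mulVec, dotProduct]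
  refine ⟨M, fun a ha => ?_, fun g => ?_⟩
  · rw [hMa] at ha
    have h0 : b.equivFun.symm a = 0 := Subtype.ext ha
    exact (LinearEquiv.map_eq_zero_iff b.equivFun.symm).mp h0
  · refine ⟨Matrix.of fun l j => b.equivFun ⟨A g *ᵥ (b j : Fin n → K), hS g _ (b j).2⟩ l, ?_⟩
    ext i j
    rw [hL, hR, hMa]
    simp only [Matrix.of_apply]
    rw [LinearEquiv.symm_apply_apply]

/-- A submodule of `Kⁿ` of CODIMENSION `1` stable under a family of matrices gives a common ROW EIGEN-COVECTOR: the
dot-product orthogonal of `S` is a line, stable under `w ↦ w ᵥ* A_g` since `(w A) · u = w · (A u)`. [folklore] -/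
theorem exists_eigencovector_of_stable_finrank_add_one (A : Γ → Matrix (Fin n) (Fin n) K)
    (S : Submodule K (Fin n → K)) (hS : ∀ g, ∀ u ∈ S, A g *ᵥ u ∈ S)
    (h3 : Module.finrank K S + 1 = n) :
    ∃ w : Fin n → K, w ≠ 0 ∧ ∀ g, ∃ c : K, w ᵥ* A g = c • w := by
  let B : LinearMap.BilinForm K (Fin n → K) := Matrix.toBilin' (1 : Matrix (Fin n) (Fin n) K)
  have hB : ∀ v w : Fin n → K, B v w = v ⬝ᵥ w := fun v w => by
    simp only [B, Matrix.toBilin'_apply', Matrix.one_mulVec]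
  have hBnd : B.Nondegenerate :=
    LinearMap.BilinForm.nondegenerate_toBilin'_of_det_ne_zero' _ (by rw [Matrix.det_one]; exact one_ne_zero)
  have hmem : ∀ w : Fin n → K, w ∈ B.orthogonal S ↔ ∀ u ∈ S, u ⬝ᵥ w = 0 := fun w => by
    simp only [LinearMap.BilinForm.mem_orthogonal_iff, hB]
  have h1 : Module.finrank K (B.orthogonal S) = 1 := by
    rw [LinearMap.BilinForm.finrank_orthogonal hBnd, Module.finrank_fin_fun]
    omega
  obtain ⟨w, hw0, hw⟩ := finrank_eq_one_iff'.mp h1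
  refine ⟨(w : Fin n → K), fun h0 => hw0 (Subtype.ext h0), fun g => ?_⟩
  have hmem' : (w : Fin n → K) ᵥ* A g ∈ B.orthogonal S := by
    rw [hmem]
    intro u hu
    rw [dotProduct_comm, ← Matrix.dotProduct_mulVec, dotProduct_comm]
    exact (hmem w).mp w.2 _ (hS g u hu)
  obtain ⟨c, hc⟩ := hw ⟨_, hmem'⟩
  exact ⟨c, by simpa using congrArg Subtype.val hc.symm⟩

end StableSubmodules

/-- **Registered sub-goal T9 `stub_irreducible_of_noStableSubspace`** (line `sector-klingen-split`, rev 7): a matrix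
representation `r : Γ → GL₄(K)` with no stable line (eigen-line of all `r g`), no stable hyperplane (row eigen-covector
of all `r g`) and no stable plane (`4 × 2` matrix `M`, injective on `K²`, with `r g M = M T_g`) is IRREDUCIBLE on `K⁴`
(Mathlib `Representation.IsIrreducible` = simple order of subrepresentations: dimension count `0 … 4`). [folklore] -/
theorem stub_irreducible_of_noStableSubspace :
    ∀ (K : Type) [Field K] (Γ : Type) [Group Γ] (r : Γ →* GL (Fin 4) K),
      (¬ ∃ v : Fin 4 → K, v ≠ 0 ∧ ∀ g, ∃ c : K, (r g).val *ᵥ v = c • v) →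
      (¬ ∃ w : Fin 4 → K, w ≠ 0 ∧ ∀ g, ∃ c : K, w ᵥ* (r g).val = c • w) →
      (¬ ∃ M : Matrix (Fin 4) (Fin 2) K, (∀ a : Fin 2 → K, M *ᵥ a = 0 → a = 0) ∧
          ∀ g, ∃ T : Matrix (Fin 2) (Fin 2) K, (r g).val * M = M * T) →
      Representation.IsIrreducible ((glStdRepresentation (Fin 4) K).comp r) := by
  intro K _ Γ _ r hline hcov hplane
  haveI : Nontrivial (Subrepresentation ((glStdRepresentation (Fin 4) K).comp r)) := by
    refine ⟨⟨⊥, ⊤, fun hbt => ?_⟩⟩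
    have h : (⊥ : Submodule K (Fin 4 → K)) = ⊤ := congrArg Subrepresentation.toSubmodule hbt
    exact bot_ne_top h
  refine ⟨fun U => ?_⟩
  have hS : ∀ g, ∀ u ∈ U.toSubmodule, (r g).val *ᵥ u ∈ U.toSubmodule := fun g u hu =>
    U.apply_mem_toSubmodule g hu
  have hle : Module.finrank K U.toSubmodule ≤ 4 := by
    have h := Submodule.finrank_le U.toSubmodule
    rwa [Module.finrank_fin_fun] at h
  obtain h | h | h | h | h : Module.finrank K U.toSubmodule = 0 ∨ Module.finrank K U.toSubmodule = 1 ∨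
      Module.finrank K U.toSubmodule = 2 ∨ Module.finrank K U.toSubmodule = 3 ∨
      Module.finrank K U.toSubmodule = 4 := by omega
  · left
    apply Subrepresentation.toSubmodule_injective
    exact Submodule.finrank_eq_zero.mp h
  · exact absurd (exists_eigenline_of_stable_finrank_eq_one (fun g => (r g).val) U.toSubmodule hS h) hline
  · exact absurd (exists_stablePlane_of_stable_finrank_eq_two (fun g => (r g).val) U.toSubmodule hS h) hplane
  · exact absurd (exists_eigencovector_of_stable_finrank_add_one (fun g => (r g).val) U.toSubmodule hS
      (by rw [h])) hcov
  · right
    apply Subrepresentation.toSubmodule_injective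
    exact Submodule.eq_top_of_finrank_eq (by rw [h, Module.finrank_fin_fun])

end Summit.Langlands.Langlands.Cruxes.ResiduallyYoshidaLifting.SectorKlingenSplit.Fibre

end
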